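import Summits.HodgeConjecture.HodgeConjecture.Theorems.F0P3cStCharTSUpTrU2OrbitTube    -- ★ (B5) LH7-p02 (g8) p852430: `conj_mul_mem_orbitTube` («ORBIT-TUBE₂ ⊆»); brings ★ (B1) `…UpTrU2Chart`
import Summits.HodgeConjecture.HodgeConjecture.Theorems.F0P3cStCharTSUpTrU2OrbitSurj    -- ★ (B6) LH7-p03 (g6) p852464: `exists_conj_eq_torus_mul_lower_mul_torus_mul_upper` («ORBIT-TUBE₂ ⊇»)
import Summits.HodgeConjecture.HodgeConjecture.Theorems.F0P3cStCharTSUpTrU2BoxProduct   -- ★ (B2b) F0P3a-p01 (g22) p852478: `exists_subgroup_coe_eq_boxProduct` (the Iwahori-type subgroup `N̄[r₁]·M_δ·N[r₂]`)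
import Summits.HodgeConjecture.HodgeConjecture.Theorems.F0P3cStCharTSUpTrU2Chart        -- ★ (B1) LH7-p02 (g8): `coe_eq_diag_of_mem_torusU`, `map_entry_mul_entry_eq_one_of_mem_torusU`; brings ★ `torusU`, `unitaryGroupOfForm`
import Summits.HodgeConjecture.HodgeConjecture.Theorems.F0P3cStCharTSWeylHypFibre        -- ★ (A0′) `isUnit_sub_of_isRegularElt_glDiagonal` (regular diagonal ⇒ distinct entries)
import Summits.HodgeConjecture.HodgeConjecture.Theorems.F0P3cStCharTSRootUnitLocConst   -- ★ `eventually_map_eq_of_continuousAt` (valuations of continuous functions are locally constant)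
import Literature.NumberTheory.Automorphic.GLnCongruenceSubgroups                        -- ★ `congruenceGL` (the levels `K_γ`)
import Literature.NumberTheory.GaloisRepresentations.LocalField                         -- ★ `IsNonarchimedeanLocalField.normAbs`, `normAbs_apply`
import HarnessLib

/-!
# F0 · P3c · line LH6 «StCharTS» — ROAD «UP-TR» brick (H4s), sub-road «JAC-LOC₂» file (B7b) «HORBIT₂ DISCHARGE»: the `horbit` letter of the model socket (B7) at
# the diagonal torus of `U(1,1) = U(σ, Φ₂)(K)` with the weight `D₂ = |a−1|·|a⁻¹−1|^{…}` (Harish-Chandra 1970 Lemma 22; van Dijk 1972 §2; Casselman 1995 Prop. 1.4.4)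

Cell `pub/hodgecm-mathlib`, crux H413 = `stmt-HodgeConjecture-24833` (lane `--supports … --as helper`, route HCCMUnconditional); seat LH4-p01 (g8), brick (B7b) of the
sub-road «JAC-LOC₂» (memo `F0/P3c/LH7/LH7-p02/g8/h4s/ROAD-JAC-LOC2.v1.LH7p02g8.md`; sub-dealer LH7-p02 (g8), DEAL #4 2026-09-02T18:56:32Z), under ROAD «UP-TR»
(holder F0P3-p02 (g23); LEAD F0P3a-plan (g15) T14-21).  THEOREMS ONLY (no definition ∕ instance ∕ notation ∕ named fact ∕ `sorry`); ★-only imports.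

WHAT.  (B7) ★ `…UpTrU2JacModel.tubeJacobianLocal_torusU_of_orbitTube` turns the model socket at the diagonal torus `T = torusU σ J` of `U′ = U(σ, J)(K)` into ONE
hypothesis `horbit` («ORBIT-TUBE + MASS on the level cosets of regular diagonal elements, `D` locally constant»).  This file DISCHARGES `horbit` for `N = 2`, `J = Φ₂`,
the levels `Kl n := K_{δ n} ∩ U′` of a schedule `δ` (`δ n < 1`, antitone, eventually below every positive bound) and the weight
`D₂ t := √(‖a(t) − 1‖ · ‖a(t)⁻¹ − 1‖)` (`a(t) = t₀₀ · σ(t₀₀)` the root value; `‖·‖ = normAbs K`), from the three ★ algebraic bricks of the sub-road, consumed BY NAME —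
(B5) «ORBIT-TUBE₂ ⊆» ★ `…UpTrU2OrbitTube.conj_mul_mem_orbitTube` (p852430), (B6) «ORBIT-TUBE₂ ⊇» ★ `…UpTrU2OrbitSurj.exists_conj_eq_torus_mul_lower_mul_torus_mul_upper` (p852464),
(B2b) «IWAHORI-TYPE BOX PRODUCT» ★ `…UpTrU2BoxProduct.exists_subgroup_coe_eq_boxProduct` (p852478) — and the SANDWICH MEASURE (B5-M)
`ν(N̄[γ|a−1|]·M_γ·N[γ|a⁻¹−1|]) = D₂ · ν(K_γ)` consumed BY SHAPE as the hypothesis `hPM` (= LH7-p03 (g6)'s letter of 2026-09-02 19:00:23Z for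
`…UpTrU2SandwichMeasure.measure_boxProduct_eq_weight_mul_measure_level`, verbatim; a one-line re-bind when that file is ★).
THE MATHEMATICS (this file's own content).  (1) A REGULAR diagonal `t₀` has root value `a₀ = a(t₀) ∉ {0, 1}` (★ `isUnit_sub_of_isRegularElt_glDiagonal`).  (2) The set
`U := {t ∈ T | v(a(t) − 1) = v(a₀ − 1) ∧ v(a(t)) = v(a₀)}` is OPEN (valuations of the continuous functions `a`, `a − 1` are locally constant off their zeros, ★
`eventually_map_eq_of_continuousAt`) and contains `t₀`; on it `v(a(t)⁻¹ − 1) = v(a(t) − 1)·v(a(t))⁻¹` is constant too, so `D₂` IS CONSTANT ON `U` (`normAbs` factors through `v`).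
(3) MARGINS: since `δ n → 0` there is `n₀` with, for all `n ≥ n₀`, `δₙ·v(a₀) < v(a₀ − 1)`, `δₙ < v(a₀ − 1)`, `δₙ·v(a₀⁻¹ − 1) ≤ 1`, `δₙ·v(a₀ − 1) ≤ 1` — and these transfer
verbatim to every `s ∈ U`.  (4) The radii `r₁ = δₙ·v(a−1)`, `r₂ = δₙ·v(a⁻¹−1)` satisfy `r₁ r₂ ≤ δₙ` (at most one of `v(a−1)`, `v(a⁻¹−1)` exceeds `1`), so (B2b) gives the
Iwahori-type SUBGROUP `P = N̄[r₁]·M_{δₙ}·N[r₂]`; (B5) puts every `k·s·τ·k⁻¹` (`k ∈ Kl n`, `τ ∈ Kl n ∩ T`) in `s·P` and (B6) produces every point of `s·P` that way: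
`{k s τ k⁻¹} = s • ↑P`; (B5-M) is the mass clause.  Output = (B7)'s `horbit` binder at `D := D₂`, `Kl n := K_{δ n} ∩ U′`, TOKEN FOR TOKEN.
HONEST LABEL (ROAD «UP-TR», LEAD T14-21 (7)): count-neutral; block consequents 11 → 10 → 9 only at the rider editions; organs 2 = 2; h413 registry untouched; HC_CM is
proved only modulo the printed citations (2 remaining named inputs: hLiu418 = `stmt-HodgeConjecture-24832`, h413 = `stmt-HodgeConjecture-24833`) until rung 0 closes.

## References
* [HarishChandra1970] Harish-Chandra (notes by G. van Dijk), *Harmonic Analysis on Reductive p-adic Groups*, LNM 162 (1970), Part V §4 Lemma 22.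
* [vanDijk1972] G. van Dijk, *Computation of certain induced characters of p-adic groups*, Math. Ann. 199 (1972), §2.
* [Casselman1995] W. Casselman, *Introduction to the theory of admissible representations of `p`-adic reductive groups* (1995 notes), Prop. 1.4.4.
* [Rogawski1990] J. D. Rogawski, *Automorphic Representations of Unitary Groups in Three Variables*, Ann. of Math. Stud. 123 (1990), §1.10 p. 9; §12.5 p. 182.
-/

set_option autoImplicit false
-- the mandated namespace has the single-problem summit's repeated segment (`HodgeConjecture.HodgeConjecture`)
set_option linter.dupNamespace false

noncomputable section

open Filter Topology Set ValuativeRel MeasureTheory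
open Literature.NumberTheory.Automorphic Literature.NumberTheory.Automorphic.UnitaryGroup Literature.NumberTheory.Rogawski1990
open Literature.NumberTheory.GaloisRepresentations.IsNonarchimedeanLocalField
open Summit.HodgeConjecture.HodgeConjecture.Cruxes.H413.F0P3cStCharTSUpTrU2Chart
open Summit.HodgeConjecture.HodgeConjecture.Cruxes.H413.F0P3cStCharTSUpTrU2OrbitTube
open Summit.HodgeConjecture.HodgeConjecture.Cruxes.H413.F0P3cStCharTSUpTrU2OrbitSurj
open Summit.HodgeConjecture.HodgeConjecture.Cruxes.H413.F0P3cStCharTSUpTrU2BoxProduct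
open Summit.HodgeConjecture.HodgeConjecture.Cruxes.H413.F0P3cStCharTSWeylHypFibre
open Summit.HodgeConjecture.HodgeConjecture.Cruxes.H413.F0P3cStCharTSRootUnitLocConst
open scoped MatrixGroups NNReal ENNReal Pointwise

namespace Summit.HodgeConjecture.HodgeConjecture.Cruxes.H413.F0P3cStCharTSUpTrU2Horbit

/-! ## §1 The root value `a(t) = t₀₀ σ(t₀₀)` of a diagonal element: regular ⇒ `a ∉ {0, 1}`; continuity -/

section RootValue

variable {K : Type*} [Field K] (σ : K →+* K) {J : Matrix (Fin 2) (Fin 2) K} (hJ : J = (StdForm.antidiagonal 2).over K)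

include hJ in
/-- The `(0,0)` entry of a diagonal element of `U(σ, Φ₂)(K)` is non-zero (`σ(t₁₁)·t₀₀ = 1`, ★ (B1)). [cite: Rogawski1990, §1.10 p. 9] -/
theorem entry_ne_zero_of_mem_torusU {s : ↥(unitaryGroupOfForm σ J)} (hs : s ∈ torusU σ J) :
    ((s : GL (Fin 2) K) : Matrix (Fin 2) (Fin 2) K) 0 0 ≠ 0 := by
  obtain ⟨-, h10⟩ := map_entry_mul_entry_eq_one_of_mem_torusU σ hJ hs
  intro h
  rw [h, mul_zero] at h10
  exact zero_ne_one h10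

include hJ in
/-- The root value `a(s) = s₀₀·σ(s₀₀)` of a diagonal element is non-zero. [cite: Rogawski1990, §1.10 p. 9] -/
theorem rootValue_ne_zero_of_mem_torusU {s : ↥(unitaryGroupOfForm σ J)} (hs : s ∈ torusU σ J) :
    ((s : GL (Fin 2) K) : Matrix (Fin 2) (Fin 2) K) 0 0 * σ (((s : GL (Fin 2) K) : Matrix (Fin 2) (Fin 2) K) 0 0) ≠ 0 := by
  obtain ⟨h01, -⟩ := map_entry_mul_entry_eq_one_of_mem_torusU σ hJ hs
  refine mul_ne_zero (entry_ne_zero_of_mem_torusU σ hJ hs) fun h => ?_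
  rw [h, zero_mul] at h01
  exact zero_ne_one h01

include hJ in
/-- **A REGULAR diagonal element of `U(σ, Φ₂)(K)` has root value `a = s₀₀·σ(s₀₀) ≠ 1`**: `s = diag(d, e)` with `σ(d)·e = 1`, and regularity makes `d − e` a unit
(★ `isUnit_sub_of_isRegularElt_glDiagonal`); `a = 1` would force `e = (σ d)⁻¹ = d`. [cite: Rogawski1990, §3.1 p. 19; §1.10 p. 9] -/
theorem rootValue_ne_one_of_isRegularElt {s : ↥(unitaryGroupOfForm σ J)} (hs : s ∈ torusU σ J) (hreg : IsRegularElt (s : GL (Fin 2) K)) :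
    ((s : GL (Fin 2) K) : Matrix (Fin 2) (Fin 2) K) 0 0 * σ (((s : GL (Fin 2) K) : Matrix (Fin 2) (Fin 2) K) 0 0) ≠ 1 := by
  obtain ⟨d, hd⟩ := (mem_torusU_iff s).1 hs
  have hreg' : IsRegularElt (glDiagonal 2 K d) := by rw [hd]; exact hreg
  have hu := isUnit_sub_of_isRegularElt_glDiagonal (d := d) hreg' (i := 0) (j := 1) (by decide)
  have e00 : ((s : GL (Fin 2) K) : Matrix (Fin 2) (Fin 2) K) 0 0 = (d 0 : K) := by
    rw [← hd, coe_glDiagonal, Matrix.diagonal_apply_eq]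
  have e11 : ((s : GL (Fin 2) K) : Matrix (Fin 2) (Fin 2) K) 1 1 = (d 1 : K) := by
    rw [← hd, coe_glDiagonal, Matrix.diagonal_apply_eq]
  obtain ⟨h01, -⟩ := map_entry_mul_entry_eq_one_of_mem_torusU σ hJ hs
  rw [e00, e11] at h01
  rw [e00]
  intro ha
  -- `σ(d 0) · d 1 = 1 = d 0 · σ(d 0)` ⇒ `d 1 = d 0`
  have hσ0 : σ (d 0 : K) ≠ 0 := fun h => by rw [h, zero_mul] at h01; exact zero_ne_one h01
  have hd1 : (d 1 : K) = (d 0 : K) := by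
    have h2 : σ (d 0 : K) * (d 1 : K) = σ (d 0 : K) * (d 0 : K) := by rw [h01, mul_comm, ha]
    exact mul_left_cancel₀ hσ0 h2
  rw [hd1, sub_self] at hu
  exact not_isUnit_zero hu

variable [TopologicalSpace K] [IsTopologicalRing K]

omit hJ in
/-- The root value `t ↦ a(t) = t₀₀·σ(t₀₀)` is CONTINUOUS on the diagonal torus (`σ` continuous). [cite: HarishChandra1970, Lemma 22] -/
theorem continuous_rootValue (hσc : Continuous σ) :
    Continuous fun t : ↥(torusU σ J) =>
      (((t : ↥(unitaryGroupOfForm σ J)) : GL (Fin 2) K) : Matrix (Fin 2) (Fin 2) K) 0 0 *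
        σ ((((t : ↥(unitaryGroupOfForm σ J)) : GL (Fin 2) K) : Matrix (Fin 2) (Fin 2) K) 0 0) := by
  have hE : Continuous fun t : ↥(torusU σ J) => (((t : ↥(unitaryGroupOfForm σ J)) : GL (Fin 2) K) : Matrix (Fin 2) (Fin 2) K) 0 0 :=
    (Units.continuous_val.comp (continuous_subtype_val.comp continuous_subtype_val)).matrix_elem 0 0
  exact hE.mul (hσc.comp hE)

end RootValue

/-! ## §2 Valuation bookkeeping: `v(a⁻¹ − 1)`, the product bound `r₁ r₂ ≤ δ`, the schedule margins -/

section Valuation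

variable {K : Type*} [Field K] [ValuativeRel K]

/-- `v(x⁻¹ − 1) = v(x − 1) · v(x)⁻¹` for `x ≠ 0`. [folklore] -/
theorem valuation_inv_sub_one {x : K} (hx : x ≠ 0) : valuation K (x⁻¹ - 1) = valuation K (x - 1) * (valuation K x)⁻¹ := by
  have h : x⁻¹ - 1 = x⁻¹ * (1 - x) := by field_simp
  rw [h, map_mul, map_inv₀, Valuation.map_sub_swap, mul_comm]

/-- `v(x) > 1 ⇒ v(x − 1) = v(x)` (ultrametric). [folklore] -/
theorem valuation_sub_one_eq_of_one_lt {x : K} (hx : 1 < valuation K x) : valuation K (x - 1) = valuation K x := by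
  rw [sub_eq_add_neg]
  refine Valuation.map_add_eq_of_lt_left _ ?_
  rwa [Valuation.map_neg, map_one]

/-- `v(x − 1) > 1 ⇒ v(x) = v(x − 1)` (ultrametric). [folklore] -/
theorem valuation_eq_of_one_lt_sub_one {x : K} (hx : 1 < valuation K (x - 1)) : valuation K x = valuation K (x - 1) := by
  have h : x = (x - 1) + 1 := by ring
  conv_lhs => rw [h]
  refine Valuation.map_add_eq_of_lt_left _ ?_
  rwa [map_one]

/-- **THE PRODUCT BOUND `r₁ r₂ ≤ δ`** for `r₁ = δ·v(a−1)`, `r₂ = δ·v(a⁻¹−1)` under the margins `δ·v(a−1) ≤ 1`, `δ·v(a⁻¹−1) ≤ 1` (`a ≠ 0`): at most one of `v(a−1)`,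
`v(a⁻¹−1)` exceeds `1` (if `v(a−1) > 1` then `v(a) = v(a−1) > 1` and `v(a⁻¹−1) = 1`) — the hypothesis `hr` of (B2b) `exists_subgroup_coe_eq_boxProduct`. [cite: Casselman1995, Prop. 1.4.4] -/
theorem radii_mul_le {a : K} (ha : a ≠ 0) {δ : ValueGroupWithZero K}
    (h3 : δ * valuation K (a⁻¹ - 1) ≤ 1) (h4 : δ * valuation K (a - 1) ≤ 1) :
    δ * valuation K (a - 1) * (δ * valuation K (a⁻¹ - 1)) ≤ δ := by
  by_cases h1 : valuation K (a - 1) ≤ 1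
  · calc δ * valuation K (a - 1) * (δ * valuation K (a⁻¹ - 1)) ≤ δ * 1 * 1 :=
          mul_le_mul' (mul_le_mul_right h1 δ) h3
      _ = δ := by rw [mul_one, mul_one]
  · have h1' : 1 < valuation K (a - 1) := lt_of_not_ge h1
    have hva : valuation K a = valuation K (a - 1) := valuation_eq_of_one_lt_sub_one h1'
    have hinv : valuation K (a⁻¹ - 1) = 1 := by
      rw [valuation_inv_sub_one ha, ← hva, mul_inv_cancel₀ ((Valuation.ne_zero_iff _).2 ha)]
    calc δ * valuation K (a - 1) * (δ * valuation K (a⁻¹ - 1)) = δ * valuation K (a - 1) * δ := by rw [hinv, mul_one]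
      _ ≤ 1 * δ := mul_le_mul_left h4 δ
      _ = δ := one_mul δ

/-- **THE SCHEDULE GOES BELOW EVERY RATIO**: if `δ n` is eventually below every non-zero bound then for `X ≠ 0 ≠ Y` some `δ n · X < Y`. [folklore] -/
theorem exists_schedule_mul_lt {δ : ℕ → ValueGroupWithZero K} (hsmall : ∀ γ : ValueGroupWithZero K, γ ≠ 0 → ∃ n, δ n < γ)
    {X Y : ValueGroupWithZero K} (hX : X ≠ 0) (hY : Y ≠ 0) : ∃ n, δ n * X < Y := by
  obtain ⟨n, hn⟩ := hsmall (Y * X⁻¹) (mul_ne_zero hY (inv_ne_zero hX))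
  refine ⟨n, ?_⟩
  calc δ n * X < Y * X⁻¹ * X := mul_lt_mul_of_pos_right hn (zero_lt_iff.2 hX)
    _ = Y := inv_mul_cancel_right₀ hX Y

end Valuation

/-! ## §3 Local constancy of the root-value sizes and of `D₂` on the torus -/

section LocConst

variable {K : Type*} [Field K] [ValuativeRel K] [TopologicalSpace K] [IsNonarchimedeanLocalField K] [IsTopologicalRing K]
  (σ : K →+* K) {J : Matrix (Fin 2) (Fin 2) K}

/-- **THE LOCUS OF CONSTANT ROOT-VALUE SIZES IS OPEN**: for `t₀ ∈ T` with `a(t₀) ∉ {0, 1}`, the set `{t | v(a(t) − 1) = v(a(t₀) − 1) ∧ v(a(t)) = v(a(t₀))}` is open in `T`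
(`a` continuous, ★ `eventually_map_eq_of_continuousAt` at every point of the set). [cite: HarishChandra1970, Lemma 22] [cite: vanDijk1972, §2] -/
theorem isOpen_setOf_valuation_rootValue_eq (hσc : Continuous σ) (t₀ : ↥(torusU σ J))
    (ha0 : ((((((t₀ : ↥(unitaryGroupOfForm σ J))) : GL (Fin 2) K) : Matrix (Fin 2) (Fin 2) K) 0 0) * σ (((((t₀ : ↥(unitaryGroupOfForm σ J))) : GL (Fin 2) K) : Matrix (Fin 2) (Fin 2) K) 0 0)) ≠ 0) (ha1 : ((((((t₀ : ↥(unitaryGroupOfForm σ J))) : GL (Fin 2) K) : Matrix (Fin 2) (Fin 2) K) 0 0) * σ (((((t₀ : ↥(unitaryGroupOfForm σ J))) : GL (Fin 2) K) : Matrix (Fin 2) (Fin 2) K) 0 0)) ≠ 1) :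
    IsOpen {t : ↥(torusU σ J) | valuation K (((((((t : ↥(unitaryGroupOfForm σ J))) : GL (Fin 2) K) : Matrix (Fin 2) (Fin 2) K) 0 0) * σ (((((t : ↥(unitaryGroupOfForm σ J))) : GL (Fin 2) K) : Matrix (Fin 2) (Fin 2) K) 0 0)) - 1) = valuation K (((((((t₀ : ↥(unitaryGroupOfForm σ J))) : GL (Fin 2) K) : Matrix (Fin 2) (Fin 2) K) 0 0) * σ (((((t₀ : ↥(unitaryGroupOfForm σ J))) : GL (Fin 2) K) : Matrix (Fin 2) (Fin 2) K) 0 0)) - 1) ∧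
      valuation K ((((((t : ↥(unitaryGroupOfForm σ J))) : GL (Fin 2) K) : Matrix (Fin 2) (Fin 2) K) 0 0) * σ (((((t : ↥(unitaryGroupOfForm σ J))) : GL (Fin 2) K) : Matrix (Fin 2) (Fin 2) K) 0 0)) = valuation K ((((((t₀ : ↥(unitaryGroupOfForm σ J))) : GL (Fin 2) K) : Matrix (Fin 2) (Fin 2) K) 0 0) * σ (((((t₀ : ↥(unitaryGroupOfForm σ J))) : GL (Fin 2) K) : Matrix (Fin 2) (Fin 2) K) 0 0))} := by
  have hcont := continuous_rootValue σ (J := J) hσc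
  refine isOpen_iff_mem_nhds.2 fun t₁ ht₁ => ?_
  obtain ⟨h₁, h₂⟩ := ht₁
  have hne1 : valuation K (((((((t₁ : ↥(unitaryGroupOfForm σ J))) : GL (Fin 2) K) : Matrix (Fin 2) (Fin 2) K) 0 0) * σ (((((t₁ : ↥(unitaryGroupOfForm σ J))) : GL (Fin 2) K) : Matrix (Fin 2) (Fin 2) K) 0 0)) - 1) ≠ 0 := by
    rw [h₁]; exact (Valuation.ne_zero_iff _).2 (sub_ne_zero.2 ha1)
  have hne2 : valuation K ((((((t₁ : ↥(unitaryGroupOfForm σ J))) : GL (Fin 2) K) : Matrix (Fin 2) (Fin 2) K) 0 0) * σ (((((t₁ : ↥(unitaryGroupOfForm σ J))) : GL (Fin 2) K) : Matrix (Fin 2) (Fin 2) K) 0 0)) ≠ 0 := by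
    rw [h₂]; exact (Valuation.ne_zero_iff _).2 ha0
  have e₁ := eventually_map_eq_of_continuousAt (valuation K) (hcont.sub continuous_const).continuousAt hne1
  have e₂ := eventually_map_eq_of_continuousAt (valuation K) hcont.continuousAt hne2
  exact (e₁.and e₂).mono fun t ht => ⟨ht.1.trans h₁, ht.2.trans h₂⟩

omit [IsTopologicalRing K] σ in
/-- `normAbs` factors through the valuation. [folklore] -/
theorem normAbs_congr_of_valuation_eq {x y : K} (h : valuation K x = valuation K y) : normAbs K x = normAbs K y := by
  rw [normAbs_apply, normAbs_apply, h]

omit [IsTopologicalRing K] in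
/-- **`D₂` IS CONSTANT ON THE LOCUS**: `v(a(t) − 1) = v(a(t₀) − 1)` and `v(a(t)) = v(a(t₀))` (`a(t₀) ≠ 0 ≠ a(t)`) ⇒ `D₂ t = D₂ t₀` (also `v(a⁻¹ − 1) = v(a − 1)·v(a)⁻¹`).
[cite: HarishChandra1970, Lemma 22] [cite: Rogawski1990, §12.5 p. 182] -/
theorem weightTwo_eq_of_valuation_eq {t t₀ : ↥(torusU σ J)} (hat : ((((((t : ↥(unitaryGroupOfForm σ J))) : GL (Fin 2) K) : Matrix (Fin 2) (Fin 2) K) 0 0) * σ (((((t : ↥(unitaryGroupOfForm σ J))) : GL (Fin 2) K) : Matrix (Fin 2) (Fin 2) K) 0 0)) ≠ 0) (ha0 : ((((((t₀ : ↥(unitaryGroupOfForm σ J))) : GL (Fin 2) K) : Matrix (Fin 2) (Fin 2) K) 0 0) * σ (((((t₀ : ↥(unitaryGroupOfForm σ J))) : GL (Fin 2) K) : Matrix (Fin 2) (Fin 2) K) 0 0)) ≠ 0)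
    (h₁ : valuation K (((((((t : ↥(unitaryGroupOfForm σ J))) : GL (Fin 2) K) : Matrix (Fin 2) (Fin 2) K) 0 0) * σ (((((t : ↥(unitaryGroupOfForm σ J))) : GL (Fin 2) K) : Matrix (Fin 2) (Fin 2) K) 0 0)) - 1) = valuation K (((((((t₀ : ↥(unitaryGroupOfForm σ J))) : GL (Fin 2) K) : Matrix (Fin 2) (Fin 2) K) 0 0) * σ (((((t₀ : ↥(unitaryGroupOfForm σ J))) : GL (Fin 2) K) : Matrix (Fin 2) (Fin 2) K) 0 0)) - 1))
    (h₂ : valuation K ((((((t : ↥(unitaryGroupOfForm σ J))) : GL (Fin 2) K) : Matrix (Fin 2) (Fin 2) K) 0 0) * σ (((((t : ↥(unitaryGroupOfForm σ J))) : GL (Fin 2) K) : Matrix (Fin 2) (Fin 2) K) 0 0)) = valuation K ((((((t₀ : ↥(unitaryGroupOfForm σ J))) : GL (Fin 2) K) : Matrix (Fin 2) (Fin 2) K) 0 0) * σ (((((t₀ : ↥(unitaryGroupOfForm σ J))) : GL (Fin 2) K) : Matrix (Fin 2) (Fin 2) K) 0 0))) :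
    NNReal.sqrt (normAbs K (((((((t : ↥(unitaryGroupOfForm σ J))) : GL (Fin 2) K) : Matrix (Fin 2) (Fin 2) K) 0 0) * σ (((((t : ↥(unitaryGroupOfForm σ J))) : GL (Fin 2) K) : Matrix (Fin 2) (Fin 2) K) 0 0)) - 1) * normAbs K ((((((((t : ↥(unitaryGroupOfForm σ J))) : GL (Fin 2) K) : Matrix (Fin 2) (Fin 2) K) 0 0) * σ (((((t : ↥(unitaryGroupOfForm σ J))) : GL (Fin 2) K) : Matrix (Fin 2) (Fin 2) K) 0 0)))⁻¹ - 1)) =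
      NNReal.sqrt (normAbs K (((((((t₀ : ↥(unitaryGroupOfForm σ J))) : GL (Fin 2) K) : Matrix (Fin 2) (Fin 2) K) 0 0) * σ (((((t₀ : ↥(unitaryGroupOfForm σ J))) : GL (Fin 2) K) : Matrix (Fin 2) (Fin 2) K) 0 0)) - 1) * normAbs K ((((((((t₀ : ↥(unitaryGroupOfForm σ J))) : GL (Fin 2) K) : Matrix (Fin 2) (Fin 2) K) 0 0) * σ (((((t₀ : ↥(unitaryGroupOfForm σ J))) : GL (Fin 2) K) : Matrix (Fin 2) (Fin 2) K) 0 0)))⁻¹ - 1)) := by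
  have h₃ : valuation K ((((((((t : ↥(unitaryGroupOfForm σ J))) : GL (Fin 2) K) : Matrix (Fin 2) (Fin 2) K) 0 0) * σ (((((t : ↥(unitaryGroupOfForm σ J))) : GL (Fin 2) K) : Matrix (Fin 2) (Fin 2) K) 0 0)))⁻¹ - 1) = valuation K ((((((((t₀ : ↥(unitaryGroupOfForm σ J))) : GL (Fin 2) K) : Matrix (Fin 2) (Fin 2) K) 0 0) * σ (((((t₀ : ↥(unitaryGroupOfForm σ J))) : GL (Fin 2) K) : Matrix (Fin 2) (Fin 2) K) 0 0)))⁻¹ - 1) := by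
    rw [valuation_inv_sub_one hat, valuation_inv_sub_one ha0, h₁, h₂]
  rw [normAbs_congr_of_valuation_eq h₁, normAbs_congr_of_valuation_eq h₃]

end LocConst

/-! ## §4 THE `horbit` LETTER OF (B7) AT `D := D₂`, `Kl n := K_{δ n} ∩ U′` -/

section Horbit

variable {K : Type*} [Field K] [ValuativeRel K] [TopologicalSpace K] [IsNonarchimedeanLocalField K] [IsTopologicalRing K]
  (σ : K →+* K) (hσ : ∀ x, σ (σ x) = x) (hσv : ∀ x, valuation K (σ x) = valuation K x) (hσc : Continuous σ)
  {J : Matrix (Fin 2) (Fin 2) K} (hJ : J = (StdForm.antidiagonal 2).over K)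
  [MeasurableSpace ↥(unitaryGroupOfForm σ J)] (ν : Measure ↥(unitaryGroupOfForm σ J))

include hσ hσv hσc hJ in
/-- **(B7b) «HORBIT₂»: the `horbit` hypothesis of ★ (B7) `…UpTrU2JacModel.tubeJacobianLocal_torusU_of_orbitTube` for `U(σ, Φ₂)(K)`, the levels `K_{δ n} ∩ U′` of a
schedule `δ` and the weight `D₂ t = √(‖a(t)−1‖·‖a(t)⁻¹−1‖)`** — from ★ (B5) «⊆» `conj_mul_mem_orbitTube` and ★ (B6) «⊇» `exists_conj_eq_torus_mul_lower_mul_torus_mul_upper` and ★ (B2b)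
`exists_subgroup_coe_eq_boxProduct` (by name), and the sandwich measure (B5-M) (`hPM`, BY SHAPE = LH7-p03 (g6)'s letter verbatim until ★).  For a REGULAR `t₀ ∈ T`: `U := {v(a−1) = v(a₀−1), v(a) = v(a₀)}` (open, `D₂` constant, §3);
`n₀` from the four margins (§2 `exists_schedule_mul_lt`); for `n ≥ n₀` and `s` with `s·(Kl n ∩ T) ⊆ U`: `P := P(δₙ·v(a_s−1), δₙ, δₙ·v(a_s⁻¹−1))` (§2 `radii_mul_le`),
`{k s τ k⁻¹} = s • ↑P` by ★ (B5)∕★ (B6), mass by `hPM`. [cite: HarishChandra1970, Lemma 22] [cite: vanDijk1972, §2] [cite: Casselman1995, Prop. 1.4.4] [cite: Rogawski1990, §12.5 p. 182] -/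
theorem horbit_torusU_two
    (δ : ℕ → ValueGroupWithZero K) (hδ1 : ∀ n, δ n < 1) (hδ0 : ∀ n, δ n ≠ 0) (hanti : Antitone δ)
    (hsmall : ∀ γ : ValueGroupWithZero K, γ ≠ 0 → ∃ n, δ n < γ)
    -- (B5-M) THE SANDWICH MEASURE BY SHAPE = LH7-p03 (g6)'s letter 19:00:23Z `…UpTrU2SandwichMeasure.measure_boxProduct_eq_weight_mul_measure_level`
    (hPM : ∀ {γ : ValueGroupWithZero K}, γ < 1 → γ ≠ 0 → ∀ {s : ↥(unitaryGroupOfForm σ J)}, s ∈ torusU σ J →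
      ((((s : GL (Fin 2) K) : Matrix (Fin 2) (Fin 2) K) 0 0) * σ (((s : GL (Fin 2) K) : Matrix (Fin 2) (Fin 2) K) 0 0)) ≠ 1 →
      γ * valuation K (((((s : GL (Fin 2) K) : Matrix (Fin 2) (Fin 2) K) 0 0) * σ (((s : GL (Fin 2) K) : Matrix (Fin 2) (Fin 2) K) 0 0)) - 1) * (γ * valuation K ((((((s : GL (Fin 2) K) : Matrix (Fin 2) (Fin 2) K) 0 0) * σ (((s : GL (Fin 2) K) : Matrix (Fin 2) (Fin 2) K) 0 0)))⁻¹ - 1)) ≤ γ →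
      ν ({x : ↥(unitaryGroupOfForm σ J) | ((x : GL (Fin 2) K) : Matrix (Fin 2) (Fin 2) K) = !![1, 0; ((x : GL (Fin 2) K) : Matrix (Fin 2) (Fin 2) K) 1 0, 1] ∧
          valuation K (((x : GL (Fin 2) K) : Matrix (Fin 2) (Fin 2) K) 1 0) ≤ γ * valuation K (((((s : GL (Fin 2) K) : Matrix (Fin 2) (Fin 2) K) 0 0) * σ (((s : GL (Fin 2) K) : Matrix (Fin 2) (Fin 2) K) 0 0)) - 1)} *
        {m : ↥(unitaryGroupOfForm σ J) | m ∈ torusU σ J ∧ (m : GL (Fin 2) K) ∈ congruenceGL 2 γ} *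
        {x : ↥(unitaryGroupOfForm σ J) | ((x : GL (Fin 2) K) : Matrix (Fin 2) (Fin 2) K) = !![1, ((x : GL (Fin 2) K) : Matrix (Fin 2) (Fin 2) K) 0 1; 0, 1] ∧
          valuation K (((x : GL (Fin 2) K) : Matrix (Fin 2) (Fin 2) K) 0 1) ≤ γ * valuation K ((((((s : GL (Fin 2) K) : Matrix (Fin 2) (Fin 2) K) 0 0) * σ (((s : GL (Fin 2) K) : Matrix (Fin 2) (Fin 2) K) 0 0)))⁻¹ - 1)}) =
        ((NNReal.sqrt (normAbs K (((((s : GL (Fin 2) K) : Matrix (Fin 2) (Fin 2) K) 0 0) * σ (((s : GL (Fin 2) K) : Matrix (Fin 2) (Fin 2) K) 0 0)) - 1) * normAbs K ((((((s : GL (Fin 2) K) : Matrix (Fin 2) (Fin 2) K) 0 0) * σ (((s : GL (Fin 2) K) : Matrix (Fin 2) (Fin 2) K) 0 0)))⁻¹ - 1)) : ℝ≥0) : ℝ≥0∞) *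
          ν (((congruenceGL 2 γ).comap (unitaryGroupOfForm σ J).subtype : Subgroup ↥(unitaryGroupOfForm σ J)) : Set ↥(unitaryGroupOfForm σ J))) :
    ∀ t₀ : ↥(torusU σ J), IsRegularElt (((t₀ : ↥(unitaryGroupOfForm σ J))) : GL (Fin 2) K) →
      ∃ U : Set ↥(torusU σ J), IsOpen U ∧ t₀ ∈ U ∧
        (∀ s ∈ U, NNReal.sqrt (normAbs K (((((((s : ↥(unitaryGroupOfForm σ J))) : GL (Fin 2) K) : Matrix (Fin 2) (Fin 2) K) 0 0) * σ (((((s : ↥(unitaryGroupOfForm σ J))) : GL (Fin 2) K) : Matrix (Fin 2) (Fin 2) K) 0 0)) - 1) * normAbs K ((((((((s : ↥(unitaryGroupOfForm σ J))) : GL (Fin 2) K) : Matrix (Fin 2) (Fin 2) K) 0 0) * σ (((((s : ↥(unitaryGroupOfForm σ J))) : GL (Fin 2) K) : Matrix (Fin 2) (Fin 2) K) 0 0)))⁻¹ - 1)) =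
          NNReal.sqrt (normAbs K (((((((t₀ : ↥(unitaryGroupOfForm σ J))) : GL (Fin 2) K) : Matrix (Fin 2) (Fin 2) K) 0 0) * σ (((((t₀ : ↥(unitaryGroupOfForm σ J))) : GL (Fin 2) K) : Matrix (Fin 2) (Fin 2) K) 0 0)) - 1) * normAbs K ((((((((t₀ : ↥(unitaryGroupOfForm σ J))) : GL (Fin 2) K) : Matrix (Fin 2) (Fin 2) K) 0 0) * σ (((((t₀ : ↥(unitaryGroupOfForm σ J))) : GL (Fin 2) K) : Matrix (Fin 2) (Fin 2) K) 0 0)))⁻¹ - 1))) ∧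
        ∃ n₀ : ℕ, ∀ n, n₀ ≤ n → ∀ s : ↥(torusU σ J),
          s • ((((congruenceGL 2 (δ n)).comap (unitaryGroupOfForm σ J).subtype : Subgroup ↥(unitaryGroupOfForm σ J)).comap (torusU σ J).subtype :
            Subgroup ↥(torusU σ J)) : Set ↥(torusU σ J)) ⊆ U →
          ∃ P : Set ↥(unitaryGroupOfForm σ J),
            {x : ↥(unitaryGroupOfForm σ J) | ∃ k ∈ (((congruenceGL 2 (δ n)).comap (unitaryGroupOfForm σ J).subtype : Subgroup ↥(unitaryGroupOfForm σ J)) : Set ↥(unitaryGroupOfForm σ J)),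
                ∃ τ ∈ (((congruenceGL 2 (δ n)).comap (unitaryGroupOfForm σ J).subtype : Subgroup ↥(unitaryGroupOfForm σ J)) : Set ↥(unitaryGroupOfForm σ J)),
                τ ∈ torusU σ J ∧ k * (s : ↥(unitaryGroupOfForm σ J)) * τ * k⁻¹ = x} = ((s : ↥(unitaryGroupOfForm σ J))) • P ∧
            ν P = ((NNReal.sqrt (normAbs K (((((((s : ↥(unitaryGroupOfForm σ J))) : GL (Fin 2) K) : Matrix (Fin 2) (Fin 2) K) 0 0) * σ (((((s : ↥(unitaryGroupOfForm σ J))) : GL (Fin 2) K) : Matrix (Fin 2) (Fin 2) K) 0 0)) - 1) * normAbs K ((((((((s : ↥(unitaryGroupOfForm σ J))) : GL (Fin 2) K) : Matrix (Fin 2) (Fin 2) K) 0 0) * σ (((((s : ↥(unitaryGroupOfForm σ J))) : GL (Fin 2) K) : Matrix (Fin 2) (Fin 2) K) 0 0)))⁻¹ - 1)) : ℝ≥0) : ℝ≥0∞) *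
              ν (((congruenceGL 2 (δ n)).comap (unitaryGroupOfForm σ J).subtype : Subgroup ↥(unitaryGroupOfForm σ J)) : Set ↥(unitaryGroupOfForm σ J)) := by
  intro t₀ ht₀
  -- (1) the root value of `t₀`
  have ha0 : ((((((t₀ : ↥(unitaryGroupOfForm σ J))) : GL (Fin 2) K) : Matrix (Fin 2) (Fin 2) K) 0 0) * σ (((((t₀ : ↥(unitaryGroupOfForm σ J))) : GL (Fin 2) K) : Matrix (Fin 2) (Fin 2) K) 0 0)) ≠ 0 := rootValue_ne_zero_of_mem_torusU σ hJ t₀.2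
  have ha1 : ((((((t₀ : ↥(unitaryGroupOfForm σ J))) : GL (Fin 2) K) : Matrix (Fin 2) (Fin 2) K) 0 0) * σ (((((t₀ : ↥(unitaryGroupOfForm σ J))) : GL (Fin 2) K) : Matrix (Fin 2) (Fin 2) K) 0 0)) ≠ 1 := rootValue_ne_one_of_isRegularElt σ hJ t₀.2 ht₀
  set a₀ : K := ((((((t₀ : ↥(unitaryGroupOfForm σ J))) : GL (Fin 2) K) : Matrix (Fin 2) (Fin 2) K) 0 0) * σ (((((t₀ : ↥(unitaryGroupOfForm σ J))) : GL (Fin 2) K) : Matrix (Fin 2) (Fin 2) K) 0 0)) with ha₀def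
  have hva0 : valuation K a₀ ≠ 0 := (Valuation.ne_zero_iff _).2 ha0
  have hva1 : valuation K (a₀ - 1) ≠ 0 := (Valuation.ne_zero_iff _).2 (sub_ne_zero.2 ha1)
  have hvai : valuation K (a₀⁻¹ - 1) ≠ 0 := by
    rw [valuation_inv_sub_one ha0]; exact mul_ne_zero hva1 (inv_ne_zero hva0)
  -- (2) the open set `U`
  refine ⟨{t : ↥(torusU σ J) | valuation K (((((((t : ↥(unitaryGroupOfForm σ J))) : GL (Fin 2) K) : Matrix (Fin 2) (Fin 2) K) 0 0) * σ (((((t : ↥(unitaryGroupOfForm σ J))) : GL (Fin 2) K) : Matrix (Fin 2) (Fin 2) K) 0 0)) - 1) = valuation K (a₀ - 1) ∧ valuation K ((((((t : ↥(unitaryGroupOfForm σ J))) : GL (Fin 2) K) : Matrix (Fin 2) (Fin 2) K) 0 0) * σ (((((t : ↥(unitaryGroupOfForm σ J))) : GL (Fin 2) K) : Matrix (Fin 2) (Fin 2) K) 0 0)) = valuation K a₀},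
    isOpen_setOf_valuation_rootValue_eq σ hσc t₀ ha0 ha1, ⟨rfl, rfl⟩, fun s hs => ?_, ?_⟩
  · -- `D₂` is constant on `U`
    have has0 : ((((((s : ↥(unitaryGroupOfForm σ J))) : GL (Fin 2) K) : Matrix (Fin 2) (Fin 2) K) 0 0) * σ (((((s : ↥(unitaryGroupOfForm σ J))) : GL (Fin 2) K) : Matrix (Fin 2) (Fin 2) K) 0 0)) ≠ 0 := rootValue_ne_zero_of_mem_torusU σ hJ s.2
    exact weightTwo_eq_of_valuation_eq σ has0 ha0 hs.1 hs.2
  -- (3) the margins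
  obtain ⟨n₁, h₁⟩ := exists_schedule_mul_lt hsmall hva0 hva1
  obtain ⟨n₂, h₂⟩ := exists_schedule_mul_lt hsmall one_ne_zero hva1
  obtain ⟨n₃, h₃⟩ := exists_schedule_mul_lt hsmall hvai one_ne_zero
  obtain ⟨n₄, h₄⟩ := exists_schedule_mul_lt hsmall hva1 one_ne_zero
  refine ⟨max (max n₁ n₂) (max n₃ n₄), fun n hn s hsU => ?_⟩
  have hn₁ : δ n ≤ δ n₁ := hanti ((le_max_left _ _).trans ((le_max_left _ _).trans hn))
  have hn₂ : δ n ≤ δ n₂ := hanti ((le_max_right _ _).trans ((le_max_left _ _).trans hn))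
  have hn₃ : δ n ≤ δ n₃ := hanti ((le_max_left _ _).trans ((le_max_right _ _).trans hn))
  have hn₄ : δ n ≤ δ n₄ := hanti ((le_max_right _ _).trans ((le_max_right _ _).trans hn))
  -- `s ∈ U` (it is `s • 1`)
  have hsU' : s ∈ {t : ↥(torusU σ J) | valuation K (((((((t : ↥(unitaryGroupOfForm σ J))) : GL (Fin 2) K) : Matrix (Fin 2) (Fin 2) K) 0 0) * σ (((((t : ↥(unitaryGroupOfForm σ J))) : GL (Fin 2) K) : Matrix (Fin 2) (Fin 2) K) 0 0)) - 1) = valuation K (a₀ - 1) ∧ valuation K ((((((t : ↥(unitaryGroupOfForm σ J))) : GL (Fin 2) K) : Matrix (Fin 2) (Fin 2) K) 0 0) * σ (((((t : ↥(unitaryGroupOfForm σ J))) : GL (Fin 2) K) : Matrix (Fin 2) (Fin 2) K) 0 0)) = valuation K a₀} := by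
    have h := hsU (Set.smul_mem_smul_set (a := s) (Subgroup.one_mem _))
    rwa [smul_eq_mul, mul_one] at h
  obtain ⟨hs₁, hs₂⟩ := hsU'
  set a : K := ((((((s : ↥(unitaryGroupOfForm σ J))) : GL (Fin 2) K) : Matrix (Fin 2) (Fin 2) K) 0 0) * σ (((((s : ↥(unitaryGroupOfForm σ J))) : GL (Fin 2) K) : Matrix (Fin 2) (Fin 2) K) 0 0)) with hadef
  have has0 : a ≠ 0 := rootValue_ne_zero_of_mem_torusU σ hJ s.2
  have has1 : a ≠ 1 := fun h => hva1 (by rw [← hs₁, h, sub_self, map_zero])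
  have hs₃ : valuation K (a⁻¹ - 1) = valuation K (a₀⁻¹ - 1) := by
    rw [valuation_inv_sub_one has0, valuation_inv_sub_one ha0, hs₁, hs₂]
  -- the four margins at `s`, `γ := δ n`
  have hγ : δ n < 1 := hδ1 n
  have m1 : δ n * valuation K a < valuation K (a - 1) := by
    rw [hs₁, hs₂]; exact (mul_le_mul_left hn₁ _).trans_lt h₁
  have m2 : δ n < valuation K (a - 1) := by
    rw [hs₁]; have h := (mul_le_mul_left hn₂ (1 : ValueGroupWithZero K)).trans_lt h₂; rwa [mul_one] at h
  have m3 : δ n * valuation K (a⁻¹ - 1) ≤ 1 := by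
    rw [hs₃]; exact ((mul_le_mul_left hn₃ _).trans h₃.le)
  have m4 : δ n * valuation K (a - 1) ≤ 1 := by
    rw [hs₁]; exact ((mul_le_mul_left hn₄ _).trans h₄.le)
  -- (4) the Iwahori-type subgroup
  obtain ⟨P, hPcoe⟩ := exists_subgroup_coe_eq_boxProduct σ hσv hJ hγ (radii_mul_le has0 m3 m4)
  refine ⟨(P : Set ↥(unitaryGroupOfForm σ J)), ?_, ?_⟩
  · -- the set identity
    ext x
    constructor
    · rintro ⟨k, hk, τ, hτ, hτT, rfl⟩
      have hkK : ((k : ↥(unitaryGroupOfForm σ J)) : GL (Fin 2) K) ∈ congruenceGL 2 (δ n) := hk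
      have hτK : ((τ : ↥(unitaryGroupOfForm σ J)) : GL (Fin 2) K) ∈ congruenceGL 2 (δ n) := hτ
      obtain ⟨nb, m, n', hnb, hZ, hmT, hmK, hn', hY, hconj⟩ := conj_mul_mem_orbitTube σ hσv hJ hγ s.2 hτT hτK hkK has1 m1 m2 m3
      refine Set.mem_smul_set.2 ⟨nb * m * n', ?_, ?_⟩
      · rw [hPcoe]
        exact Set.mem_mul.2 ⟨nb * m, Set.mem_mul.2 ⟨nb, ⟨hnb, hZ⟩, m, ⟨hmT, hmK⟩, rfl⟩, n', ⟨hn', hY⟩, rfl⟩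
      · rw [smul_eq_mul, ← hconj]
        simp only [mul_assoc]
    · intro hx
      obtain ⟨p, hp, rfl⟩ := Set.mem_smul_set.1 hx
      rw [hPcoe] at hp
      obtain ⟨q, hq, n', hn', rfl⟩ := Set.mem_mul.1 hp
      obtain ⟨nb, hnb, m, hm, rfl⟩ := Set.mem_mul.1 hq
      obtain ⟨k, hkK, τ, hτT, hτK, hconj⟩ :=
        exists_conj_eq_torus_mul_lower_mul_torus_mul_upper σ hJ hσ hσc s.2 hm.1 hm.2 has1 hγ m2 m3 hnb.1 hnb.2 hn'.1 hn'.2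
      refine ⟨k, hkK, τ, hτK, hτT, ?_⟩
      rw [smul_eq_mul, ← hconj]
      simp only [mul_assoc]
  · -- the mass
    rw [hPcoe]
    exact hPM hγ (hδ0 n) s.2 has1 (radii_mul_le has0 m3 m4)

end Horbit

end Summit.HodgeConjecture.HodgeConjecture.Cruxes.H413.F0P3cStCharTSUpTrU2Horbit

end
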